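import Literature.NumberTheory.EllipticCurves.HeWei2025.PStabilityHeckeLValues
import Literature.NumberTheory.EllipticCurves.Hsieh2012.NonvanishingHeckeLValuesModPProofs
import Literature.NumberTheory.GaloisRepresentations.TeichmullerCharacter
import Literature.NumberTheory.GaloisRepresentations.GlobalArtinMapNormProofs
import HarnessLib

/-!
# He 2025 (Math. Ann. 392), Theorem 1.4 (2) — bookkeeping for the statement file
# `PStabilityHeckeLValues.lean`

Proof file (theorems only, no new definition, no named fact, nothing asserted beyond what is
proved): the elementary relations between the typed objects of the statement file and those of
the sibling `Hsieh2012/NonvanishingHeckeLValuesModP.lean` —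
* `Γ̂` (`lPowerAnticyclotomicFreeFamily`, the infinitely `ℓ`-divisible part of Hsieh's `X⁻_𝔩`) is
  contained in `X⁻_𝔩`, contains `1`, is closed under inverses and products (it is the character
  group of `Γ ≅ ℤ_ℓ^d`), and consists of finite-order characters;
* Hsieh's (NV) (all values integral, cofinitely many units on `X⁻_𝔩`) implies the He-shaped
  conclusion `NVInfinite` (integral off a finite set, units on an infinite subset of `Γ̂`) as soon
  as `Γ̂` is infinite — so `NVInfinite` is the WEAKER predicate, as it must be;
* THE DELTA TO HSIEH 2012 IS EXACTLY ONE BINDER: on characters unramified above `p`,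
  `Hsieh2012.rem69_NV_of_isSelfDual` already gives the conclusion of
  `HeWei2025.thm14_NVInfinite_of_isSelfDual` (`nvInfinite_of_rem69`); conversely He's fact is
  consumed binder-for-binder like `rem69` minus `∀ w, p ∈ w → χ.IsUnramifiedAt w`
  (`nvInfinite_of_thm14`, the consumer shape for the `p ∣ cond χ` branch of BSD item 21341);
* the consumer shape of `NVInfinite`: `Γ̂` is infinite, and some (indeed infinitely many) `ν ∈ Γ̂`
  has all its normalised continuation values of `p`-adic norm exactly `1`.
BSD is not touched; item 21341 is not closed by this.

References: [HeWei2025MathAnn] W. He, Math. Ann. 392 (2025) 399–468 = arXiv:2308.15051, p. 3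
(`Γ`, `Γ̂`, integrality), Thm. 1.4 (2), §6.2 (`Cl′_∞ = Δ × Γ`); [Hsieh2012] M.-L. Hsieh, Amer. J.
Math. 134 (2012), p. 1 ((NV), `X⁻_𝔩`), Rem. 6.9 (1).
-/

noncomputable section

open scoped Classical
open NumberField IsDedekindDomain
open Literature.NumberTheory.GaloisRepresentations
open Literature.NumberTheory.EllipticCurves.Hsieh2012

namespace Literature.NumberTheory.EllipticCurves.HeWei2025

/-! ### §3. The family `Γ̂` -/

section Family

variable {K : Type} [Field K] [NumberField K] [IsCMField K]

/-- `Γ̂ ⊆ X⁻_𝔩`: He's characters of the `ℤ_ℓ`-free quotient are among Hsieh's finite-order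
characters of `Γ⁻`. [cite: HeWei2025MathAnn, p. 3 (`Γ` = maximal `ℤ_ℓ`-free quotient)] -/
theorem lPowerAnticyclotomicFreeFamily_subset (ℓ : ℕ) (𝔏 : HeightOneSpectrum (𝓞 K)) :
    lPowerAnticyclotomicFreeFamily ℓ 𝔏 ⊆ lPowerAnticyclotomicFamily (K := K) ℓ 𝔏 :=
  fun _ hν ↦ hν.1

/-- Unfolding lemma for membership in `Γ̂`. [cite: HeWei2025MathAnn, p. 3 (`Γ̂`)] -/
theorem mem_lPowerAnticyclotomicFreeFamily_iff {ℓ : ℕ} {𝔏 : HeightOneSpectrum (𝓞 K)}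
    {ν : HeckeCharacter K} :
    ν ∈ lPowerAnticyclotomicFreeFamily ℓ 𝔏 ↔ ν ∈ lPowerAnticyclotomicFamily ℓ 𝔏 ∧
      ∀ n : ℕ, ∃ ν' ∈ lPowerAnticyclotomicFamily ℓ 𝔏, ν' ^ ℓ ^ n = ν :=
  Iff.rfl

/-- Members of `Γ̂` have finite order (`ℓ ≥ 1`). [cite: HeWei2025MathAnn, p. 3 ("finite order characters `ε ∈ Γ̂`")] -/
theorem isFiniteOrder_of_mem_lPowerAnticyclotomicFreeFamily {ℓ : ℕ} (hℓ : 0 < ℓ)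
    {𝔏 : HeightOneSpectrum (𝓞 K)} {ν : HeckeCharacter K}
    (hν : ν ∈ lPowerAnticyclotomicFreeFamily ℓ 𝔏) : ν.IsFiniteOrder :=
  isFiniteOrder_of_mem_lPowerAnticyclotomicFamily hℓ hν.1

/-- The trivial character lies in `Γ̂` (`1 = 1^{ℓⁿ}`). [cite: HeWei2025MathAnn, p. 3 (`Γ̂`)] -/
theorem one_mem_lPowerAnticyclotomicFreeFamily (ℓ : ℕ) (𝔏 : HeightOneSpectrum (𝓞 K)) :
    (1 : HeckeCharacter K) ∈ lPowerAnticyclotomicFreeFamily ℓ 𝔏 :=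
  ⟨one_mem_lPowerAnticyclotomicFamily ℓ 𝔏,
    fun _ ↦ ⟨1, one_mem_lPowerAnticyclotomicFamily ℓ 𝔏, one_pow _⟩⟩

/-- `Γ̂` is closed under inverses (`(ν′⁻¹)^{ℓⁿ} = (ν′^{ℓⁿ})⁻¹`). [cite: HeWei2025MathAnn, p. 3 (`Γ̂`)] -/
theorem inv_mem_lPowerAnticyclotomicFreeFamily {ℓ : ℕ} {𝔏 : HeightOneSpectrum (𝓞 K)}
    {ν : HeckeCharacter K} (hν : ν ∈ lPowerAnticyclotomicFreeFamily ℓ 𝔏) :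
    ν⁻¹ ∈ lPowerAnticyclotomicFreeFamily ℓ 𝔏 := by
  refine ⟨inv_mem_lPowerAnticyclotomicFamily hν.1, fun n ↦ ?_⟩
  obtain ⟨ν', hν', rfl⟩ := hν.2 n
  exact ⟨ν'⁻¹, inv_mem_lPowerAnticyclotomicFamily hν', by rw [inv_pow]⟩

/-- `Γ̂` is closed under products (`(ν′μ′)^{ℓⁿ} = ν′^{ℓⁿ}μ′^{ℓⁿ}`). [cite: HeWei2025MathAnn, p. 3 (`Γ̂`)] -/
theorem mul_mem_lPowerAnticyclotomicFreeFamily {ℓ : ℕ} {𝔏 : HeightOneSpectrum (𝓞 K)}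
    {ν μ : HeckeCharacter K} (hν : ν ∈ lPowerAnticyclotomicFreeFamily ℓ 𝔏)
    (hμ : μ ∈ lPowerAnticyclotomicFreeFamily ℓ 𝔏) :
    ν * μ ∈ lPowerAnticyclotomicFreeFamily ℓ 𝔏 := by
  refine ⟨mul_mem_lPowerAnticyclotomicFamily hν.1 hμ.1, fun n ↦ ?_⟩
  obtain ⟨ν', hν', rfl⟩ := hν.2 n
  obtain ⟨μ', hμ', rfl⟩ := hμ.2 n
  exact ⟨ν' * μ', mul_mem_lPowerAnticyclotomicFamily hν' hμ', by rw [mul_pow]⟩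

/-- `Γ̂` is closed under powers. [cite: HeWei2025MathAnn, p. 3 (`Γ̂`)] -/
theorem pow_mem_lPowerAnticyclotomicFreeFamily {ℓ : ℕ} {𝔏 : HeightOneSpectrum (𝓞 K)}
    {ν : HeckeCharacter K} (hν : ν ∈ lPowerAnticyclotomicFreeFamily ℓ 𝔏) (m : ℕ) :
    ν ^ m ∈ lPowerAnticyclotomicFreeFamily ℓ 𝔏 := by
  induction m with
  | zero => simpa using one_mem_lPowerAnticyclotomicFreeFamily ℓ 𝔏
  | succ m ih => simpa [pow_succ] using mul_mem_lPowerAnticyclotomicFreeFamily ih hν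

end Family

/-! ### §4. `NVInfinite` versus Hsieh's `NV`, and the consumer shape -/

section NV

variable {K : Type} [Field K] [NumberField K] [IsCMField K] {p : ℕ} [Fact p.Prime]

/-- Hsieh's `(NV)` (all values integral, all but finitely many units, over the whole of `X⁻_𝔩`)
implies `NVInfinite` as soon as `Γ̂` is infinite (it is: `Γ ≅ ℤ_ℓ^d`, `d ≥ 1` — not asserted
here). So the He-shaped conclusion is the WEAKER predicate, as it must be (no integrality for all
twists and no cofiniteness when `p ∣ cond χ`).
[cite: HeWei2025MathAnn, p. 3 (integrality "for almost all `λ ∈ 𝒳`") and Theorem 1.4 (2)]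
[cite: Hsieh2012, p. 1 ((NV))] -/
theorem nvInfinite_of_nv (ι : PadicAlgCl p ≃+* ℂ) (ℓ : ℕ) (𝔏 : HeightOneSpectrum (𝓞 K))
    (χ : HeckeCharacter K) (k : ℕ) (κ : InfinitePlace K → ℕ)
    (hX : (lPowerAnticyclotomicFreeFamily ℓ 𝔏 : Set (HeckeCharacter K)).Infinite)
    (h : NV ι ℓ 𝔏 χ k κ) : NVInfinite ι ℓ 𝔏 χ k κ := by
  obtain ⟨Ω, hΩ, hint, hfin⟩ := h
  refine ⟨Ω, hΩ, ?_, ?_⟩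
  · -- no value exceeds 1: the bad set is empty
    refine Set.Finite.subset (Set.finite_empty) ?_
    rintro ν ⟨hν, hL, hgt⟩
    exact absurd (hint ν hν.1 hL) (not_le.mpr hgt)
  · -- good set ⊇ Γ̂ minus Hsieh's finite exceptional set
    refine Set.Infinite.mono ?_ (hX.sdiff hfin)
    rintro ν ⟨hν, hνexc⟩
    refine ⟨hν, fun hL => ?_⟩
    have hle := hint ν hν.1 hL
    have hnlt : ¬ ‖ι.symm (algebraicLValue k κ Ω 𝔏 (χ * ν) (hL.continuation 0))‖ < 1 := by
      intro hlt
      exact hνexc ⟨hν.1, hL, hlt⟩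
    exact le_antisymm hle (not_lt.mp hnlt)

/-- `NVInfinite` records in particular that `Γ̂` is infinite (the good set is an infinite subset
of it) — the rank statement `d ≥ 1` seen through the typed conclusion.
[cite: HeWei2025MathAnn, Theorem 1.4 (2) ("Zariski dense `λ ∈ 𝒳^m`")] -/
theorem NVInfinite.infinite_family {ι : PadicAlgCl p ≃+* ℂ} {ℓ : ℕ} {𝔏 : HeightOneSpectrum (𝓞 K)}
    {χ : HeckeCharacter K} {k : ℕ} {κ : InfinitePlace K → ℕ} (h : NVInfinite ι ℓ 𝔏 χ k κ) :
    (lPowerAnticyclotomicFreeFamily (K := K) ℓ 𝔏).Infinite := by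
  obtain ⟨_, _, -, hinf⟩ := h
  exact Set.Infinite.mono (fun ν hν ↦ hν.1) hinf

/-- The consumer shape "there are infinitely many twists with unit `L`-value mod `p`": under
`NVInfinite` there is a period vector for which infinitely many `ν ∈ Γ̂` have all their
normalised continuation values of `p`-adic norm exactly `1`.
[cite: HeWei2025MathAnn, Theorem 1.4 (2)] -/
theorem NVInfinite.exists_infinite_norm_eq_one {ι : PadicAlgCl p ≃+* ℂ} {ℓ : ℕ}
    {𝔏 : HeightOneSpectrum (𝓞 K)} {χ : HeckeCharacter K} {k : ℕ} {κ : InfinitePlace K → ℕ}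
    (h : NVInfinite ι ℓ 𝔏 χ k κ) :
    ∃ Ω : InfinitePlace K → ℂ, (∀ w, Ω w ≠ 0) ∧
      {ν : HeckeCharacter K | ν ∈ lPowerAnticyclotomicFreeFamily ℓ 𝔏 ∧
        ∀ hL : LFunction.HasEntireContinuation (heckeLFunction (χ * ν)),
          ‖ι.symm (algebraicLValue k κ Ω 𝔏 (χ * ν) (hL.continuation 0))‖ = 1}.Infinite := by
  obtain ⟨Ω, hΩ, -, hinf⟩ := h
  exact ⟨Ω, hΩ, hinf⟩

/-- The consumer shape "there is ONE twist with unit `L`-value mod `p`": under `NVInfinite` some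
`ν ∈ Γ̂` (a finite-order anticyclotomic character of `ℓ`-power order and `𝔩`-power conductor)
has all its normalised continuation values of `p`-adic norm exactly `1`.
[cite: HeWei2025MathAnn, Theorem 1.4 (2)] -/
theorem NVInfinite.exists_forall_norm_eq_one {ι : PadicAlgCl p ≃+* ℂ} {ℓ : ℕ}
    {𝔏 : HeightOneSpectrum (𝓞 K)} {χ : HeckeCharacter K} {k : ℕ} {κ : InfinitePlace K → ℕ}
    (h : NVInfinite ι ℓ 𝔏 χ k κ) :
    ∃ Ω : InfinitePlace K → ℂ, (∀ w, Ω w ≠ 0) ∧ ∃ ν ∈ lPowerAnticyclotomicFreeFamily ℓ 𝔏,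
      ∀ hL : LFunction.HasEntireContinuation (heckeLFunction (χ * ν)),
        ‖ι.symm (algebraicLValue k κ Ω 𝔏 (χ * ν) (hL.continuation 0))‖ = 1 := by
  obtain ⟨Ω, hΩ, -, hinf⟩ := h
  obtain ⟨ν, hν, hgood⟩ := hinf.nonempty
  exact ⟨Ω, hΩ, ν, hν, hgood⟩

/-- Outside the finite bad set every continuation value is `p`-integral: the two clauses of
`NVInfinite` combined say that all but finitely many `ν ∈ Γ̂` have all their values of norm
`≤ 1`. [cite: HeWei2025MathAnn, p. 3 ("for almost all `λ ∈ 𝒳`, `𝓛(λ) ∈ ℤ̄_p ∩ ℚ̄`")] -/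
theorem NVInfinite.finite_not_norm_le_one {ι : PadicAlgCl p ≃+* ℂ} {ℓ : ℕ}
    {𝔏 : HeightOneSpectrum (𝓞 K)} {χ : HeckeCharacter K} {k : ℕ} {κ : InfinitePlace K → ℕ}
    (h : NVInfinite ι ℓ 𝔏 χ k κ) :
    ∃ Ω : InfinitePlace K → ℂ, (∀ w, Ω w ≠ 0) ∧
      {ν : HeckeCharacter K | ν ∈ lPowerAnticyclotomicFreeFamily ℓ 𝔏 ∧
        ¬ ∀ hL : LFunction.HasEntireContinuation (heckeLFunction (χ * ν)),
          ‖ι.symm (algebraicLValue k κ Ω 𝔏 (χ * ν) (hL.continuation 0))‖ ≤ 1}.Finite := by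
  obtain ⟨Ω, hΩ, hfin, -⟩ := h
  refine ⟨Ω, hΩ, hfin.subset ?_⟩
  rintro ν ⟨hν, hbad⟩
  refine ⟨hν, ?_⟩
  by_contra hno
  exact hbad fun hL ↦ le_of_not_gt fun hgt ↦ hno ⟨hL, hgt⟩

end NV

/-! ### §5. The delta to Hsieh 2012, mechanically -/

section Delta

/-- **The delta is exactly one binder.** On characters UNRAMIFIED ABOVE `p`, Hsieh's Remark 6.9 (1)
as typed next door (`Hsieh2012.rem69_NV_of_isSelfDual`, conclusion `NV`) already yields the
He-shaped conclusion `NVInfinite` (granted `Γ̂` infinite — true, `Γ ≅ ℤ_ℓ`, not asserted here). So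
`thm14_NVInfinite_of_isSelfDual` differs from `rem69_NV_of_isSelfDual` precisely by (a) DROPPING
the binder `∀ w, p ∈ w → χ.IsUnramifiedAt w` (He: "we allow `p` to divide the conductor") and
(b) weakening `NV` (all integral, cofinitely many units on `X⁻_𝔩`) to `NVInfinite` (integral off a
finite set, infinitely many units on `Γ̂`). Binder-for-binder the two facts are otherwise identical.
[cite: HeWei2025MathAnn, Theorem 1.4 (2) and p. 3 ("we allow `p` to divide the conductor of Hecke character")]
[cite: Hsieh2012, Remark 6.9 (1) (p. 24)] -/
theorem nvInfinite_of_rem69 (h : rem69_NV_of_isSelfDual)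
    (p : ℕ) [Fact p.Prime] (hp : 2 < p)
    (K : Type) [Field K] [NumberField K] [IsCMField K]
    (hunr : ¬ (p : ℤ) ∣ NumberField.discr (maximalRealSubfield K))
    (ι : PadicAlgCl p ≃+* ℂ) (Sp : Finset (HeightOneSpectrum (𝓞 K)))
    (hSp : KatzCM.IsPAdicCMType p Sp)
    (ℓ : ℕ) (𝔏 : HeightOneSpectrum (𝓞 K)) (hℓ : ℓ.Prime) (hℓp : ℓ ≠ p)
    (h𝔏 : ((ℓ : ℕ) : 𝓞 K) ∈ 𝔏.asIdeal) (hsplit : IsCMField.complexConj K • 𝔏 ≠ 𝔏)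
    (he : 𝔏.asIdeal.ramificationIdx ℤ = 1) (hf : 𝔏.asIdeal.inertiaDeg ℤ = 1)
    (χ : HeckeCharacter K) (κ : InfinitePlace K → ℕ)
    (hχ : KatzCM.HasKatzType ι Sp χ 1 κ) (hsd : IsSelfDual χ)
    (hCp : ∀ w : HeightOneSpectrum (𝓞 K), ((p : ℕ) : 𝓞 K) ∈ w.asIdeal → χ.IsUnramifiedAt w)
    (hC𝔏 : χ.IsUnramifiedAt 𝔏) (hC𝔏' : χ.IsUnramifiedAt (IsCMField.complexConj K • 𝔏))
    (hL : ∀ w : HeightOneSpectrum (𝓞 K), IsCMField.complexConj K • w = w → ¬ χ.IsUnramifiedAt w →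
      HasLocalMuZero ι χ w)
    (hR : IsSelfDualRootNumber κ χ 1)
    (hX : (lPowerAnticyclotomicFreeFamily ℓ 𝔏 : Set (HeckeCharacter K)).Infinite) :
    NVInfinite ι ℓ 𝔏 χ 1 κ :=
  nvInfinite_of_nv ι ℓ 𝔏 χ 1 κ hX
    (h p hp K hunr ι Sp hSp ℓ 𝔏 hℓ hℓp h𝔏 hsplit he hf χ κ hχ hsd hCp hC𝔏 hC𝔏' hL hR)

/-- Consumer shape: He's fact is consumed binder-for-binder like `Hsieh2012.rem69_NV_of_isSelfDual`
MINUS the binder "`χ` unramified above `p`" — the `p ∣ cond χ` branch (BSD item 21341, where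
`Ψ = ψ_W ∘ N_{L/K_CM}` is ramified above `p`). Consumers holding `rem69` AND `p ∤ cond χ` should keep
using `rem69` (stronger conclusion `NV`).
[cite: HeWei2025MathAnn, Theorem 1.4 (2) = Theorem 6.1 (2)] -/
theorem nvInfinite_of_thm14 (h : thm14_NVInfinite_of_isSelfDual)
    (p : ℕ) [Fact p.Prime] (hp : 2 < p)
    (K : Type) [Field K] [NumberField K] [IsCMField K]
    (hunr : ¬ (p : ℤ) ∣ NumberField.discr (maximalRealSubfield K))
    (ι : PadicAlgCl p ≃+* ℂ) (Sp : Finset (HeightOneSpectrum (𝓞 K)))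
    (hSp : KatzCM.IsPAdicCMType p Sp)
    (ℓ : ℕ) (𝔏 : HeightOneSpectrum (𝓞 K)) (hℓ : ℓ.Prime) (hℓp : ℓ ≠ p)
    (h𝔏 : ((ℓ : ℕ) : 𝓞 K) ∈ 𝔏.asIdeal) (hsplit : IsCMField.complexConj K • 𝔏 ≠ 𝔏)
    (he : 𝔏.asIdeal.ramificationIdx ℤ = 1) (hf : 𝔏.asIdeal.inertiaDeg ℤ = 1)
    (χ : HeckeCharacter K) (κ : InfinitePlace K → ℕ)
    (hχ : KatzCM.HasKatzType ι Sp χ 1 κ) (hsd : IsSelfDual χ)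
    (hC𝔏 : χ.IsUnramifiedAt 𝔏) (hC𝔏' : χ.IsUnramifiedAt (IsCMField.complexConj K • 𝔏))
    (hL : ∀ w : HeightOneSpectrum (𝓞 K), IsCMField.complexConj K • w = w → ¬ χ.IsUnramifiedAt w →
      HasLocalMuZero ι χ w)
    (hR : IsSelfDualRootNumber κ χ 1) :
    NVInfinite ι ℓ 𝔏 χ 1 κ :=
  h p hp K hunr ι Sp hSp ℓ 𝔏 hℓ hℓp h𝔏 hsplit he hf χ κ hχ hsd hC𝔏 hC𝔏' hL hR

/-- The same consumer shape, closed form: He's fact yields, on the `p ∣ cond χ` branch, a period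
vector and ONE `ν ∈ Γ̂` all of whose normalised continuation values are `p`-adic units — the
"`L`-value that IS a unit mod `p` for some anticyclotomic `ℓ`-power twist" of the BED lead's
(C3-unit) audit. [cite: HeWei2025MathAnn, Theorem 1.4 (2) = Theorem 6.1 (2)] -/
theorem exists_unit_twist_of_thm14 (h : thm14_NVInfinite_of_isSelfDual)
    (p : ℕ) [Fact p.Prime] (hp : 2 < p)
    (K : Type) [Field K] [NumberField K] [IsCMField K]
    (hunr : ¬ (p : ℤ) ∣ NumberField.discr (maximalRealSubfield K))
    (ι : PadicAlgCl p ≃+* ℂ) (Sp : Finset (HeightOneSpectrum (𝓞 K)))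
    (hSp : KatzCM.IsPAdicCMType p Sp)
    (ℓ : ℕ) (𝔏 : HeightOneSpectrum (𝓞 K)) (hℓ : ℓ.Prime) (hℓp : ℓ ≠ p)
    (h𝔏 : ((ℓ : ℕ) : 𝓞 K) ∈ 𝔏.asIdeal) (hsplit : IsCMField.complexConj K • 𝔏 ≠ 𝔏)
    (he : 𝔏.asIdeal.ramificationIdx ℤ = 1) (hf : 𝔏.asIdeal.inertiaDeg ℤ = 1)
    (χ : HeckeCharacter K) (κ : InfinitePlace K → ℕ)
    (hχ : KatzCM.HasKatzType ι Sp χ 1 κ) (hsd : IsSelfDual χ)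
    (hC𝔏 : χ.IsUnramifiedAt 𝔏) (hC𝔏' : χ.IsUnramifiedAt (IsCMField.complexConj K • 𝔏))
    (hL : ∀ w : HeightOneSpectrum (𝓞 K), IsCMField.complexConj K • w = w → ¬ χ.IsUnramifiedAt w →
      HasLocalMuZero ι χ w)
    (hR : IsSelfDualRootNumber κ χ 1) :
    ∃ Ω : InfinitePlace K → ℂ, (∀ w, Ω w ≠ 0) ∧ ∃ ν ∈ lPowerAnticyclotomicFreeFamily ℓ 𝔏,
      ∀ hL' : LFunction.HasEntireContinuation (heckeLFunction (χ * ν)),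
        ‖ι.symm (algebraicLValue 1 κ Ω 𝔏 (χ * ν) (hL'.continuation 0))‖ = 1 :=
  (h p hp K hunr ι Sp hSp ℓ 𝔏 hℓ hℓp h𝔏 hsplit he hf χ κ hχ hsd hC𝔏 hC𝔏' hL
    hR).exists_forall_norm_eq_one

end Delta

/-! ### §6. Discharging the local hypothesis (L) from a root-of-unity value -/

section LocalMu

variable {K : Type} [Field K] [NumberField K] {p : ℕ} [Fact p.Prime]

/-- **(L) from one root-of-unity value of order prime to `p`.** If every value of the local
component `χ_w` is `p`-integral under `ι⁻¹` and `χ_w(u) = ζ` is a primitive `n`-th root of unity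
for some `u ∈ K_w^×` with `1 < n`, `p ∤ n`, then `μ_p(χ_w) = 0` in the typed sense
`Hsieh2012.HasLocalMuZero ι χ w`: `‖ι⁻¹(χ_w(x)) − 1‖ ≤ max(‖ι⁻¹χ_w(x)‖, 1) ≤ 1` for all `x`, and
`‖ι⁻¹(ζ) − 1‖ = 1` because roots of unity of order prime to `p` are incongruent modulo `𝔪`
(`norm_one_sub_pow_eq_one`, from `∏_{0<k<n}(1 − ζ^k) = n`). This is He's remark in the proof of
Lemma 6.2: "If exists `u ∈ 𝒪_{K,w}^×` such that `1 − λ_w(u)` is a `p`-adic unit, then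
`μ_p(λ_w) = 0`", with the unit criterion made explicit — the form in which (L) holds on the BSD
branch (a CM Grössencharacter composed with a norm takes on local units the values of a
character of order dividing `#𝒪_{K_CM}^× ∈ {2, 4, 6}`, prime to `p ≥ 5`).
[cite: HeWei2025MathAnn, Lemma 6.2 (proof, §6.1) and Corollary 5.2 (`μ_p(λ_v)`)] -/
theorem hasLocalMuZero_of_isPrimitiveRoot {ι : PadicAlgCl p ≃+* ℂ} {χ : HeckeCharacter K}
    {w : HeightOneSpectrum (𝓞 K)}
    (hint : ∀ x : (w.adicCompletion K)ˣ, ‖ι.symm ((χ.localComponent w x : ℂˣ) : ℂ)‖ ≤ 1)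
    {u : (w.adicCompletion K)ˣ} {n : ℕ} (hn : 1 < n) (hpn : ¬ p ∣ n)
    (hζ : IsPrimitiveRoot ((χ.localComponent w u : ℂˣ) : ℂ) n) :
    HasLocalMuZero ι χ w := by
  refine ⟨fun x ↦ ?_, ⟨u, ?_⟩⟩
  · rw [map_sub, map_one, sub_eq_add_neg]
    refine (IsUltrametricDist.norm_add_le_max _ _).trans ?_
    rw [norm_neg, norm_one]
    exact max_le (hint x) le_rfl
  · have hζ' : IsPrimitiveRoot (ι.symm ((χ.localComponent w u : ℂˣ) : ℂ)) n :=
      hζ.map_of_injective ι.symm.injective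
    have h := norm_one_sub_pow_eq_one hζ' hpn Nat.one_pos hn
    rw [pow_one] at h
    rw [map_sub, map_one, norm_sub_rev]
    exact h

/-- The same with the hypothesis "`χ_w(u)` is a root of unity `≠ 1` of some order `m` prime to
`p`" (`ζ^m = 1`, `ζ ≠ 1`, `p ∤ m`): then `ζ` is a primitive root of order `orderOf ζ ∣ m`,
`> 1`, prime to `p`. [cite: HeWei2025MathAnn, Lemma 6.2 (proof, §6.1)] -/
theorem hasLocalMuZero_of_pow_eq_one {ι : PadicAlgCl p ≃+* ℂ} {χ : HeckeCharacter K}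
    {w : HeightOneSpectrum (𝓞 K)}
    (hint : ∀ x : (w.adicCompletion K)ˣ, ‖ι.symm ((χ.localComponent w x : ℂˣ) : ℂ)‖ ≤ 1)
    {u : (w.adicCompletion K)ˣ} {m : ℕ} (hpm : ¬ p ∣ m)
    (hpow : ((χ.localComponent w u : ℂˣ) : ℂ) ^ m = 1)
    (hne : ((χ.localComponent w u : ℂˣ) : ℂ) ≠ 1) :
    HasLocalMuZero ι χ w := by
  set ζ : ℂ := ((χ.localComponent w u : ℂˣ) : ℂ) with hζdef
  have hm0 : m ≠ 0 := by
    rintro rfl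
    exact hpm (dvd_zero p)
  have hfin : IsOfFinOrder ζ := isOfFinOrder_iff_pow_eq_one.mpr ⟨m, Nat.pos_of_ne_zero hm0, hpow⟩
  have hprim : IsPrimitiveRoot ζ (orderOf ζ) := IsPrimitiveRoot.orderOf ζ
  have hdvd : orderOf ζ ∣ m := orderOf_dvd_of_pow_eq_one hpow
  have hgt : 1 < orderOf ζ := by
    have hpos : 0 < orderOf ζ := hfin.orderOf_pos
    have hne1 : orderOf ζ ≠ 1 := fun h ↦ hne (orderOf_eq_one_iff.mp h)
    omega
  have hp' : ¬ p ∣ orderOf ζ := fun h ↦ hpm (h.trans hdvd)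
  exact hasLocalMuZero_of_isPrimitiveRoot hint hgt hp' hprim

end LocalMu

/-! ### §7. (L) for a base-changed character: values on units come from the base -/

section BaseChange

variable {F E : Type} [Field F] [Field E] [Algebra F E] [NumberField F] [NumberField E]
  [IsGalois F E] {p : ℕ} [Fact p.Prime]

/-- **Values of `ω ∘ N_{E/F}` on local units are values of `ω` on local units**: if `ω_v(u′)^m = 1` for every unit `u′` of `F_v` (`v = w|_F`), then
`(ω ∘ N_{E/F})_w(u)^m = 1` for every unit `u` of `E_w` (the norm of a local unit is a local unit:
`N_{E/F}⟨u⟩_w = ⟨u′⟩_v`, the tree's `exists_ideleRelNorm_localUnits_eq`, Cassels–Fröhlich VII §6.3).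
At the BSD data: `ψ_W` takes values in `μ_m`, `m = #𝒪_{K_CM}^×`, on local units, hence so does
`Ψ = ψ_W ∘ N_{L/K_CM}`. [cite: CasselsFrohlichANT1967, Ch. VII §6.3 (norms of local units)] -/
theorem compRelNorm_localComponent_pow_eq_one {ω : HeckeCharacter F} {m : ℕ}
    (w : HeightOneSpectrum (𝓞 E))
    (h : ∀ u' : ((w.under (𝓞 F)).adicCompletion F)ˣ,
      Valued.v (u' : (w.under (𝓞 F)).adicCompletion F) = 1 →
        (ω.localComponent (w.under (𝓞 F)) u') ^ m = 1)
    (u : (w.adicCompletion E)ˣ) (hu : Valued.v (u : w.adicCompletion E) = 1) :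
    ((ω.compRelNorm E).localComponent w u) ^ m = 1 := by
  obtain ⟨u', hu', heq⟩ := exists_ideleRelNorm_localUnits_eq (F := F) w u hu
  have h' := h u' hu'
  rw [HeckeCharacter.localComponent_apply] at h' ⊢
  rw [HeckeCharacter.compRelNorm_apply, heq]
  exact h'

omit [IsGalois F E] in
/-- A character RAMIFIED at `w` has a local unit with value `≠ 1` (negation of the tree's
`isUnramifiedAt_iff_forall_valued_eq_one`). [cite: NeukirchANT1999, Ch. VII §6 (6.10)–(6.11)] -/
theorem exists_localComponent_ne_one_of_not_isUnramifiedAt {χ : HeckeCharacter E}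
    {w : HeightOneSpectrum (𝓞 E)} (hw : ¬ χ.IsUnramifiedAt w) :
    ∃ u : (w.adicCompletion E)ˣ, Valued.v (u : w.adicCompletion E) = 1 ∧ χ.localComponent w u ≠ 1 := by
  rw [HeckeCharacter.isUnramifiedAt_iff_forall_valued_eq_one] at hw
  push Not at hw
  obtain ⟨u, hu, hne⟩ := hw
  exact ⟨u, hu, by rwa [HeckeCharacter.localComponent_apply]⟩

/-- **(L) for `Ψ = ω ∘ N_{E/F}` at a ramified place from an `m`-torsion base**: if `ω_v(u′)^m = 1`
on the units of `F_v` (`v = w|_F`) with `p ∤ m`, `Ψ` is ramified at `w`, and every value of `Ψ_w`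
is `p`-integral under `ι⁻¹`, then `Hsieh2012.HasLocalMuZero ι Ψ w` (`μ_p(Ψ_w) = 0`): the ramified
unit value is a root of unity `≠ 1` of order prime to `p` (`hasLocalMuZero_of_pow_eq_one`). The BED
shape: `m = #𝒪_{K_CM}^× ∈ {2, 4, 6}`, `p ≥ 5`. [cite: HeWei2025MathAnn, Lemma 6.2 (proof) and Corollary 5.2] -/
theorem hasLocalMuZero_compRelNorm_of_units_pow_eq_one (ι : PadicAlgCl p ≃+* ℂ)
    {ω : HeckeCharacter F} {m : ℕ} (hpm : ¬ p ∣ m) (w : HeightOneSpectrum (𝓞 E))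
    (h : ∀ u' : ((w.under (𝓞 F)).adicCompletion F)ˣ,
      Valued.v (u' : (w.under (𝓞 F)).adicCompletion F) = 1 →
        (ω.localComponent (w.under (𝓞 F)) u') ^ m = 1)
    (hram : ¬ (ω.compRelNorm E).IsUnramifiedAt w)
    (hint : ∀ x : (w.adicCompletion E)ˣ,
      ‖ι.symm (((ω.compRelNorm E).localComponent w x : ℂˣ) : ℂ)‖ ≤ 1) :
    HasLocalMuZero ι (ω.compRelNorm E) w := by
  obtain ⟨u, hu, hne⟩ := exists_localComponent_ne_one_of_not_isUnramifiedAt hram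
  have hpow := compRelNorm_localComponent_pow_eq_one (ω := ω) w h u hu
  refine hasLocalMuZero_of_pow_eq_one (u := u) (m := m) hint hpm ?_ ?_
  · rw [← Units.val_pow_eq_pow_val, hpow, Units.val_one]
  · exact fun h1 ↦ hne (Units.val_eq_one.mp h1)

end BaseChange

end Literature.NumberTheory.EllipticCurves.HeWei2025

end
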